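import Mathlib
import Summits.NavierStokesRegularity.FluidComputer.BorderedResolventFredholm

/-!
# THEOREM R (unbordered resolvent certificate) in resolvent coordinates: head inverse + coercive tail ⇒ `‖S₀ w‖ ≤ M₀‖R_z w‖` ⇒ `R_z` invertible with `‖S₀ R_z⁻¹‖ ≤ M₀` (profile-cert-3 g4, cell `ns-blowup`, 2026-08-26)

HONEST FRAMING (human rulings D-0035/D-0074): nothing here is a claim about Navier–Stokes blow-up.
WHAT THIS IS NOT: not NS evidence. Abstract Hilbert-space theorems; their consumer is the UNBORDERED
head/tail resolvent certificate (cap `SKEWCUT-PAIR.md` §9 / cert-1 `NONRESONANCE-impl1.md` Theorem R /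
CERT-ROPE-X0 §B (a) without the border = SKEWCUT-CERT Thm 1′(a) with its constant) behind every
NON-RESONANCE row of GROUP B (`CertificateAbcResolvent*`, three implementations, 35 + 68 + 6 anchors;
the F5 layer of Z4-a(2), RULING (x)(1)): at a complex anchor `z`, a certified head inverse
(`θ < 1 ⇒ α₀`), the tail coercivity `μ` and the couplings `β_B, β_C` give
`M := √((1 + β_C²)/μ² + (α₀ + β_B√(1 + β_C²)/μ)²) ≥ ‖(z − L|class)⁻¹‖`, hence `σ(L|class) ∩ {|w − z| < 1/M} = ∅`.
Companion of the seat's bordered series (`BorderedResolventFredholm`, `BorderedHeadTailBound`,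
`BorderedResolventIsolation`, `BorderedEigenpairMaster`): the unbordered case = drop the `𝕜`-slot.

RESOLVENT COORDINATES (instab4 `SkewCutGalerkin*`): `S₀ = (x₀ − L₀)⁻¹` compact injective preserving
the head `U` and the tail `Uᗮ`, `T = A S₀`, `1 − T` invertible, `D(L) = range S₀`,
`(z − L)(S₀ w) = R_z w`, `R_z = 1 − T − (x₀ − z)S₀` bounded; so «`‖(z − L)⁻¹‖ ≤ M`» reads: `R_z` is a
bijection of `H` and `‖S₀ (R_z⁻¹ f)‖ ≤ M‖f‖`.

* §1 `resolvent_apriori_bound_of_head_tail` — HEAD: a linear LEFT inverse `Ainv` of the head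
  compression `u ↦ P (R u)` on `U` (the certified `θ = ‖X̃A₀ − I‖ < 1`) with `‖S₀ (Ainv y)‖ ≤ α‖y‖`
  (`α = α₀` in the `v = S₀ w` measure), `‖S₀ (Ainv (P R w))‖ ≤ β_B‖S₀ w‖` on `Uᗮ`,
  `‖(1 − P) R (Ainv y)‖ ≤ β_C‖y‖`; TAIL: `μ‖S₀ w‖² ≤ Re⟪R w − R (Ainv (P R w)), S₀ w⟫` on `Uᗮ` (exactly
  the `hcoer` of `SkewCutGalerkinInjectivity.injective_of_head_tail_coercive`, there consumed for
  injectivity only). CONCLUSION: `‖S₀ w‖ ≤ M₀‖R w‖` for ALL `w` (`CertifierNormBounds.sq_add_sq_le_backSubst`).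
* §2 `resolvent_inverse_of_apriori` — such a bound with `S₀` compact injective and `1 − T` invertible
  makes `R_z` INVERTIBLE (Fredholm alternative, `BorderedResolventFredholm.isUnit_resolventCoord_of_injective`)
  with a two-sided inverse `Rinv` and `‖S₀ ∘ Rinv‖ ≤ M₀`; `resolvent_inverse_of_head_tail` composes §1 + §2
  — Theorem R's «`z ∉ σ(L)`, `‖(z − L)⁻¹‖ ≤ M`» WITHOUT a Lax–Milgram step. The disc clause
  `‖(w − L)⁻¹‖ ≤ M/(1 − M|w − z|)` is then `CertifierNormBounds.resolvent_disc_transport` /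
  `resolvent_isUnit_of_near` below.

What stays model-specific: that the certifier's `A₀(z)`, `B_K`, `C_K`, `Q̃` are the blocks of THIS `R_z`
in the class basis and the (F1)–(F3)/Lemma-S bookkeeping behind `μ` (instab4 `KERNEL-CHAIN.md` §2);
plus each program's outward-rounding claim. Mathlib + `BorderedResolventFredholm` (hence
`CertifierNormBounds`); no new definitions. bears_on LADDER-NS N5 / Z4-a(2); evidence-only for
`EpisodeBase` (stmt-NavierStokesRegularity-19179).
-/

open scoped InnerProductSpace

namespace Summit.NavierStokesRegularity.FluidComputer.ResolventHeadTailBound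

variable {𝕜 H : Type*} [RCLike 𝕜] [NormedAddCommGroup H] [InnerProductSpace 𝕜 H]

/-! ## §1 The a-priori bound `‖S₀ w‖ ≤ M₀‖R w‖` from head/tail data -/

/-- **Theorem R, STEPS 2–3 as an a-priori estimate (unbordered head, coercive tail,
back-substitution).** `P` the star projection onto a complete subspace `U` (head); `S₀` preserving `U`
and `Uᗮ`; `R` bounded; a linear LEFT inverse `Ainv` of the head compression on `U`,
`Ainv (P (R u)) = u` for `u ∈ U`, with `‖S₀ (Ainv y)‖ ≤ α‖y‖` (`y ∈ U`),
`‖S₀ (Ainv (P (R w)))‖ ≤ β_B‖S₀ w‖` (`w ∈ Uᗮ`), `‖R (Ainv y) − P (R (Ainv y))‖ ≤ β_C‖y‖` (`y ∈ U`), and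
the tail Schur coercivity `μ‖S₀ w‖² ≤ Re⟪R w − R (Ainv (P (R w))), S₀ w⟫` (`w ∈ Uᗮ`, `μ > 0`). Then for
every `w`, `‖S₀ w‖ ≤ √((1 + β_C²)/μ² + (α + β_B√(1 + β_C²)/μ)²) · ‖R w‖`. [folklore] -/
theorem resolvent_apriori_bound_of_head_tail (R S₀ : H →L[𝕜] H) (U : Submodule 𝕜 H)
    [U.HasOrthogonalProjection]
    (hS₀U : ∀ u ∈ U, S₀ u ∈ U) (hS₀U' : ∀ w ∈ Uᗮ, S₀ w ∈ Uᗮ)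
    (Ainv : H →ₗ[𝕜] H) (hAleft : ∀ u ∈ U, Ainv (U.starProjection (R u)) = u)
    {α βB βC μ : ℝ} (hμ : 0 < μ) (hα : 0 ≤ α) (hβB : 0 ≤ βB) (hβC : 0 ≤ βC)
    (hαb : ∀ y ∈ U, ‖S₀ (Ainv y)‖ ≤ α * ‖y‖)
    (hβBb : ∀ w ∈ Uᗮ, ‖S₀ (Ainv (U.starProjection (R w)))‖ ≤ βB * ‖S₀ w‖)
    (hβCb : ∀ y ∈ U, ‖R (Ainv y) - U.starProjection (R (Ainv y))‖ ≤ βC * ‖y‖)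
    (hcoer : ∀ w ∈ Uᗮ, μ * ‖S₀ w‖ ^ 2 ≤
      RCLike.re ⟪R w - R (Ainv (U.starProjection (R w))), S₀ w⟫_𝕜)
    (w : H) :
    ‖S₀ w‖ ≤ √((1 + βC ^ 2) / μ ^ 2 + (α + βB * √(1 + βC ^ 2) / μ) ^ 2) * ‖R w‖ := by
  set P := U.starProjection with hP
  set wh : H := P w with hwh
  set wT : H := w - P w with hwT
  have hwhU : wh ∈ U := U.starProjection_apply_mem w
  have hwTU : wT ∈ Uᗮ := U.sub_starProjection_mem_orthogonal w
  have hsplit : w = wh + wT := by rw [hwh, hwT]; abel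
  set f : H := R w with hf
  set fh : H := P f with hfh
  set fT : H := f - P f with hfT
  have hfhU : fh ∈ U := U.starProjection_apply_mem f
  have hfTU : fT ∈ Uᗮ := U.sub_starProjection_mem_orthogonal f
  have hRw : R w = R wh + R wT := by rw [← map_add, ← hsplit]
  -- head identity and head bound
  have hhead : P (R wh) = fh - P (R wT) := by
    rw [hfh, hf, hRw, map_add]; abel
  set a : H := Ainv (P (R wT)) with ha
  have hwh' : wh = Ainv fh - a := by
    rw [← hAleft wh hwhU, hhead, map_sub]
  have hH : ‖S₀ wh‖ ≤ α * ‖fh‖ + βB * ‖S₀ wT‖ := by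
    rw [hwh', map_sub]
    exact (norm_sub_le _ _).trans (add_le_add (hαb fh hfhU) (hβBb wT hwTU))
  -- tail identity: the Schur form at `wT` is `fT - (1 - P) R (Ainv fh)` up to a vector of `U`
  have hS₀wT : S₀ wT ∈ Uᗮ := hS₀U' wT hwTU
  have htail : RCLike.re ⟪R wT - R a, S₀ wT⟫_𝕜 =
      RCLike.re ⟪fT - (R (Ainv fh) - P (R (Ainv fh))), S₀ wT⟫_𝕜 := by
    have hRa : R a = R (Ainv fh) - R wh := by rw [hwh', map_sub]; abel
    have hdiff : (R wT - R a) - (fT - (R (Ainv fh) - P (R (Ainv fh)))) =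
        P f - P (R (Ainv fh)) := by
      rw [hRa, hfT, hf, hRw]; abel
    have hdiffU : (R wT - R a) - (fT - (R (Ainv fh) - P (R (Ainv fh)))) ∈ U := by
      rw [hdiff]
      exact U.sub_mem (U.starProjection_apply_mem _) (U.starProjection_apply_mem _)
    have h0 : ⟪(R wT - R a) - (fT - (R (Ainv fh) - P (R (Ainv fh)))), S₀ wT⟫_𝕜 = 0 :=
      Submodule.inner_right_of_mem_orthogonal hdiffU hS₀wT
    rw [inner_sub_left, sub_eq_zero] at h0
    rw [h0]
  have hTb : ‖S₀ wT‖ ≤ (‖fT‖ + βC * ‖fh‖) / μ := by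
    have hc := hcoer wT hwTU
    rw [htail] at hc
    have hcs : RCLike.re ⟪fT - (R (Ainv fh) - P (R (Ainv fh))), S₀ wT⟫_𝕜 ≤
        ‖fT - (R (Ainv fh) - P (R (Ainv fh)))‖ * ‖S₀ wT‖ := re_inner_le_norm _ _
    have hn : ‖fT - (R (Ainv fh) - P (R (Ainv fh)))‖ ≤ ‖fT‖ + βC * ‖fh‖ :=
      (norm_sub_le _ _).trans (add_le_add le_rfl (hβCb fh hfhU))
    have hpos : 0 ≤ ‖fT‖ + βC * ‖fh‖ := by positivity
    rw [le_div_iff₀ hμ]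
    have h3 : μ * ‖S₀ wT‖ ^ 2 ≤ (‖fT‖ + βC * ‖fh‖) * ‖S₀ wT‖ :=
      hc.trans (hcs.trans (mul_le_mul_of_nonneg_right hn (norm_nonneg _)))
    by_cases hs : ‖S₀ wT‖ = 0
    · rw [hs, zero_mul]; exact hpos
    · have hs' : 0 < ‖S₀ wT‖ := lt_of_le_of_ne (norm_nonneg _) (Ne.symm hs)
      rw [pow_two, ← mul_assoc] at h3
      rw [mul_comm]
      exact le_of_mul_le_mul_right h3 hs'
  -- combine (Pythagoras across `U ⊕ Uᗮ`)
  have key := CertifierNormBounds.sq_add_sq_le_backSubst hμ (norm_nonneg fh) (norm_nonneg fT)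
    (norm_nonneg (S₀ wh)) (norm_nonneg (S₀ wT)) hα hβB hβC hTb hH
  have hS₀w : ‖S₀ w‖ ^ 2 = ‖S₀ wh‖ ^ 2 + ‖S₀ wT‖ ^ 2 := by
    rw [hsplit, map_add]
    have h := norm_add_sq_eq_norm_sq_add_norm_sq_of_inner_eq_zero (S₀ wh) (S₀ wT)
      (Submodule.inner_right_of_mem_orthogonal (hS₀U wh hwhU) hS₀wT)
    simpa [sq] using h
  have hfn : ‖f‖ ^ 2 = ‖fh‖ ^ 2 + ‖fT‖ ^ 2 := by
    have hfs : f = fh + fT := by rw [hfh, hfT]; abel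
    have h := norm_add_sq_eq_norm_sq_add_norm_sq_of_inner_eq_zero fh fT
      (Submodule.inner_right_of_mem_orthogonal hfhU hfTU)
    rw [← hfs] at h
    simpa [sq] using h
  have hM : 0 ≤ (1 + βC ^ 2) / μ ^ 2 + (α + βB * √(1 + βC ^ 2) / μ) ^ 2 := by positivity
  have h1 : ‖S₀ w‖ ^ 2 ≤ (√((1 + βC ^ 2) / μ ^ 2 + (α + βB * √(1 + βC ^ 2) / μ) ^ 2) * ‖f‖) ^ 2 := by
    rw [mul_pow, Real.sq_sqrt hM, hS₀w, hfn]
    exact key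
  exact (pow_le_pow_iff_left₀ (norm_nonneg _) (by positivity) two_ne_zero).mp h1

/-! ## §2 Invertibility and the resolvent bound by the Fredholm alternative -/

/-- **Injectivity from the a-priori bound**: `‖S₀ w‖ ≤ M‖R w‖` for all `w` and `S₀` injective ⇒ `R`
injective. [folklore] -/
theorem injective_of_apriori (R S₀ : H →L[𝕜] H) (hS₀ : Function.Injective S₀) {M : ℝ}
    (hapr : ∀ w, ‖S₀ w‖ ≤ M * ‖R w‖) : Function.Injective R := by
  refine (injective_iff_map_eq_zero _).mpr fun w hw => hS₀ ?_
  have h := hapr w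
  rw [hw, norm_zero, mul_zero] at h
  rw [map_zero]
  exact norm_le_zero_iff.mp h

variable [CompleteSpace H]

/-- **Theorem R in resolvent coordinates, from the a-priori bound.** `S₀` compact and injective,
`1 − T` invertible, `R = 1 − T − c•S₀` (`c = x₀ − z`) with `‖S₀ w‖ ≤ M‖R w‖` for all `w` (`M ≥ 0`). Then
`R` is invertible: there is a continuous linear two-sided inverse `Rinv`, and `‖S₀ (Rinv f)‖ ≤ M‖f‖`
— i.e. `z − L : D(L) → H` is a bijection with `‖(z − L)⁻¹‖ ≤ M` (`(z − L)⁻¹ = S₀ ∘ Rinv`). Existence by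
the Fredholm alternative, no Lax–Milgram. [folklore] -/
theorem resolvent_inverse_of_apriori (S₀ T : H →L[𝕜] H) (hS₀c : IsCompactOperator S₀)
    (hS₀ : Function.Injective S₀) (hT : IsUnit ((1 : H →L[𝕜] H) - T)) (c : 𝕜) {M : ℝ} (hM : 0 ≤ M)
    (hapr : ∀ w, ‖S₀ w‖ ≤ M * ‖((1 : H →L[𝕜] H) - T - c • S₀) w‖) :
    ∃ Rinv : H →L[𝕜] H, (∀ f, ((1 : H →L[𝕜] H) - T - c • S₀) (Rinv f) = f) ∧
      (∀ w, Rinv (((1 : H →L[𝕜] H) - T - c • S₀) w) = w) ∧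
      ‖S₀ ∘L Rinv‖ ≤ M ∧ ∀ f, ‖S₀ (Rinv f)‖ ≤ M * ‖f‖ := by
  set R : H →L[𝕜] H := (1 : H →L[𝕜] H) - T - c • S₀ with hR
  obtain ⟨u, hu⟩ := BorderedResolventFredholm.isUnit_resolventCoord_of_injective S₀ T hS₀c hT c
    (injective_of_apriori R S₀ hS₀ hapr)
  set Ri : H →L[𝕜] H := ↑u⁻¹ with hRi
  have hRu : ∀ f, R (Ri f) = f := fun f => by
    rw [hR, ← hu, hRi, ← ContinuousLinearMap.comp_apply, ← ContinuousLinearMap.mul_def,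
      Units.mul_inv]; rfl
  have huR : ∀ w, Ri (R w) = w := fun w => by
    rw [hR, ← hu, hRi, ← ContinuousLinearMap.comp_apply, ← ContinuousLinearMap.mul_def,
      Units.inv_mul]; rfl
  have hb : ∀ f, ‖S₀ (Ri f)‖ ≤ M * ‖f‖ := fun f => by
    have h := hapr (Ri f)
    rwa [hRu] at h
  exact ⟨Ri, hRu, huR, ContinuousLinearMap.opNorm_le_bound _ hM fun f => hb f, hb⟩

/-- **Theorem R from the ROW DATA.** Head left inverse with `α, β_B, β_C`, tail coercivity `μ` for
`R = 1 − T − c•S₀` (§1) with `S₀` compact injective preserving `U`, `Uᗮ` and `1 − T` invertible ⇒ `R` has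
a two-sided continuous inverse `Rinv` with `‖S₀ (Rinv f)‖ ≤ M₀‖f‖`,
`M₀ = √((1 + β_C²)/μ² + (α + β_B√(1 + β_C²)/μ)²)` — the printed `M` of every resolvent / non-resonance
row: `z ∉ σ(L)` and `‖(z − L)⁻¹‖ ≤ M`. [folklore] -/
theorem resolvent_inverse_of_head_tail (S₀ T : H →L[𝕜] H) (hS₀c : IsCompactOperator S₀)
    (hS₀ : Function.Injective S₀) (hT : IsUnit ((1 : H →L[𝕜] H) - T)) (c : 𝕜)
    (U : Submodule 𝕜 H) [U.HasOrthogonalProjection]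
    (hS₀U : ∀ u ∈ U, S₀ u ∈ U) (hS₀U' : ∀ w ∈ Uᗮ, S₀ w ∈ Uᗮ)
    (Ainv : H →ₗ[𝕜] H)
    (hAleft : ∀ u ∈ U, Ainv (U.starProjection (((1 : H →L[𝕜] H) - T - c • S₀) u)) = u)
    {α βB βC μ : ℝ} (hμ : 0 < μ) (hα : 0 ≤ α) (hβB : 0 ≤ βB) (hβC : 0 ≤ βC)
    (hαb : ∀ y ∈ U, ‖S₀ (Ainv y)‖ ≤ α * ‖y‖)
    (hβBb : ∀ w ∈ Uᗮ,
      ‖S₀ (Ainv (U.starProjection (((1 : H →L[𝕜] H) - T - c • S₀) w)))‖ ≤ βB * ‖S₀ w‖)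
    (hβCb : ∀ y ∈ U, ‖((1 : H →L[𝕜] H) - T - c • S₀) (Ainv y) -
      U.starProjection (((1 : H →L[𝕜] H) - T - c • S₀) (Ainv y))‖ ≤ βC * ‖y‖)
    (hcoer : ∀ w ∈ Uᗮ, μ * ‖S₀ w‖ ^ 2 ≤
      RCLike.re ⟪((1 : H →L[𝕜] H) - T - c • S₀) w - ((1 : H →L[𝕜] H) - T - c • S₀)
        (Ainv (U.starProjection (((1 : H →L[𝕜] H) - T - c • S₀) w))), S₀ w⟫_𝕜) :
    ∃ Rinv : H →L[𝕜] H, (∀ f, ((1 : H →L[𝕜] H) - T - c • S₀) (Rinv f) = f) ∧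
      (∀ w, Rinv (((1 : H →L[𝕜] H) - T - c • S₀) w) = w) ∧
      ‖S₀ ∘L Rinv‖ ≤ √((1 + βC ^ 2) / μ ^ 2 + (α + βB * √(1 + βC ^ 2) / μ) ^ 2) ∧
      ∀ f, ‖S₀ (Rinv f)‖ ≤ √((1 + βC ^ 2) / μ ^ 2 + (α + βB * √(1 + βC ^ 2) / μ) ^ 2) * ‖f‖ :=
  resolvent_inverse_of_apriori S₀ T hS₀c hS₀ hT c (Real.sqrt_nonneg _)
    (resolvent_apriori_bound_of_head_tail ((1 : H →L[𝕜] H) - T - c • S₀) S₀ U hS₀U hS₀U' Ainv hAleft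
      hμ hα hβB hβC hαb hβBb hβCb hcoer)

/-- **The excluded disc (`Mdisc`/`deltaMax` columns).** From the a-priori bound with constant `M > 0`
at `c = x₀ − z`: for every `c'` with `‖c' − c‖ < 1/M` (i.e. `|z' − z| < 1/M = δ_max`) the operator
`1 − T − c'•S₀` is again INVERTIBLE — `z' ∉ σ(L)` on the whole disc; the quantitative bound
`M/(1 − M|z' − z|)` for `‖S₀ R_{z'}⁻¹‖` is `CertifierNormBounds.resolvent_disc_transport`'s arithmetic
(transfer of the a-priori bound: `‖S₀ w‖ ≤ M‖R_z w‖ ≤ M(‖R_{z'} w‖ + |c' − c|‖S₀ w‖)`). [folklore] -/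
theorem resolvent_isUnit_of_near (S₀ T : H →L[𝕜] H) (hS₀c : IsCompactOperator S₀)
    (hS₀ : Function.Injective S₀) (hT : IsUnit ((1 : H →L[𝕜] H) - T)) (c c' : 𝕜) {M : ℝ}
    (hM : 0 < M) (hapr : ∀ w, ‖S₀ w‖ ≤ M * ‖((1 : H →L[𝕜] H) - T - c • S₀) w‖)
    (hnear : ‖c' - c‖ < 1 / M) :
    IsUnit ((1 : H →L[𝕜] H) - T - c' • S₀) ∧
      ∀ w, ‖S₀ w‖ ≤ M / (1 - M * ‖c' - c‖) * ‖((1 : H →L[𝕜] H) - T - c' • S₀) w‖ := by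
  have hMδ : M * ‖c' - c‖ < 1 := by
    calc M * ‖c' - c‖ < M * (1 / M) := mul_lt_mul_of_pos_left hnear hM
      _ = 1 := mul_one_div_cancel hM.ne'
  have hapr' : ∀ w, ‖S₀ w‖ ≤ M / (1 - M * ‖c' - c‖) * ‖((1 : H →L[𝕜] H) - T - c' • S₀) w‖ := by
    intro w
    have hdiff : ((1 : H →L[𝕜] H) - T - c' • S₀) w - ((1 : H →L[𝕜] H) - T - c • S₀) w =
        -((c' - c) • S₀ w) := by
      simp only [FunLike.coe_sub, FunLike.coe_smul, Pi.sub_apply, Pi.smul_apply, sub_smul]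
      abel
    have hP : ‖((1 : H →L[𝕜] H) - T - c' • S₀) w - ((1 : H →L[𝕜] H) - T - c • S₀) w‖ ≤
        ‖c' - c‖ * ‖S₀ w‖ := by
      rw [hdiff, norm_neg, norm_smul]
    have h1 : ‖((1 : H →L[𝕜] H) - T - c • S₀) w‖ ≤
        ‖((1 : H →L[𝕜] H) - T - c' • S₀) w‖ + ‖c' - c‖ * ‖S₀ w‖ := by
      calc ‖((1 : H →L[𝕜] H) - T - c • S₀) w‖
          = ‖((1 : H →L[𝕜] H) - T - c' • S₀) w - (((1 : H →L[𝕜] H) - T - c' • S₀) w -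
              ((1 : H →L[𝕜] H) - T - c • S₀) w)‖ := by rw [sub_sub_cancel]
        _ ≤ ‖((1 : H →L[𝕜] H) - T - c' • S₀) w‖ + ‖((1 : H →L[𝕜] H) - T - c' • S₀) w -
              ((1 : H →L[𝕜] H) - T - c • S₀) w‖ := norm_sub_le _ _
        _ ≤ ‖((1 : H →L[𝕜] H) - T - c' • S₀) w‖ + ‖c' - c‖ * ‖S₀ w‖ := add_le_add le_rfl hP
    have h2 := hapr w
    have hpos : 0 < 1 - M * ‖c' - c‖ := sub_pos.mpr hMδ
    rw [div_mul_eq_mul_div, le_div_iff₀ hpos]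
    nlinarith [norm_nonneg (((1 : H →L[𝕜] H) - T - c' • S₀) w), mul_le_mul_of_nonneg_left h1 hM.le,
      norm_nonneg (S₀ w)]
  exact ⟨BorderedResolventFredholm.isUnit_resolventCoord_of_injective S₀ T hS₀c hT c'
    (injective_of_apriori _ S₀ hS₀ hapr'), hapr'⟩

end Summit.NavierStokesRegularity.FluidComputer.ResolventHeadTailBound
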